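import Summits.CriticalPhenomena.PercolationContinuityZ3.Theses.PercSubharmonicSquare

/-!
# Line `convexity_amplification` for the crux `SubharmonicPower` (stmt-CriticalPhenomena-11505),
# route `PercSubharmonicSquare`, sub-problem `PercolationContinuityZ3` — strategist seat, 2026-08-17

Crux BY NAME: `Summit.CriticalPhenomena.PercolationContinuityZ3.Theses.PercSubharmonicSquare.SubharmonicPower`
`= ∃ s > 0, R, ∀ p < p_c(ℤ³), ∀ ‖x‖ > R, τ_p(0,x)^s ≤ (1/6) Σ_i [τ_p(0,x+e_i)^s + τ_p(0,x-e_i)^s]`.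

## Idea (strategist decomposition = BC2 redirect of the RESTATED deciding crux)

Do not look for the exponent `s`. Split the crux into two statements about `τ_p` itself on the
six-neighbour ring `N(x)`, with ring mean `m = (1/6) Σ_{y ∈ N(x)} τ_p(0,y)`:

* PIECE 1 `DefectSubMeanValue` — `∃ A ≥ 0, R: τ_p(0,x) ≤ (1 + A/‖x‖²) m` for `p < p_c`, `‖x‖ > R`
  (the `s = 1` sub-mean-value property up to a relative `O(r⁻²)` defect; WORLD-NEUTRAL: exponentials and
  plateau approaches have defect `≤ 1/(6r²)`, the critical law `r^{-(1+η)}` has `a(1-a)/(6r²)`);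
* PIECE 2 `RingDispersion` — `∃ B > 0, R: (1 + B/‖x‖²) m² ≤ (1/6) Σ_{y ∈ N(x)} τ_p(0,y)²`
  (relative ring variance `≥ B/r²`: the ring is never flat; no sign content, no decay content);

and PROVE `PIECE 1 → PIECE 2 → SubharmonicPower` (`subharmonicPower_of_pieces`, sorry-free, ~300 lines):
CONVEXITY AMPLIFICATION — raising to the power `q` turns ring dispersion into a Jensen gain of order
`q(q-1)B/r²` that absorbs the defect loss `qA/r²` once `q - 1 ≥ 8A/B`; two regimes (large dispersion:
global bound `t^q ≥ 1 + q(t-1) + (q-1)(t-1)²`, `t ≥ 0`; small dispersion: all six deviations are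
`≤ 1/(2q)` and the local bound `(1+u)^q ≥ 1 + qu + q(q-1)u²/4` applies). Output: `s = q := ⌈8A/B⌉₊ + 2`,
`R := max(R₁, R₂, 1, ⌈96 q² A⌉₊)`. (At `p_c`: `A ≈ 0.007`, `B ≈ 0.3`, so `q = 2` — the card's
`SquareSubharmonic`.)

Each piece is then cut once more by the `p`-UNIFORM local regime indicator `τ_p(0,x)·‖x‖`
(`≤ δ`: massive / Ornstein–Zernike regime `‖x‖ ≳ ξ(p) log(1/δ)`; `> δ`: critical window):

## Stubs (4; sorries only here)

* `stub_massiveDefect` (`∃ δ A R`) — defect sub-mean-value in the massive regime. Plausible: the OZ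
  profile `e^{-r/ξ}/r` has `Δu = +u/ξ²`; `p ≤ 1/6` is the PROVED `SmallDensitySubharmonic` (`A = 0`).
  Size L: uniform-in-`p` Ornstein–Zernike control up to second differences (CIV 2008 is fixed-`p`).
* `stub_windowDefect` (`∀ δ, ∃ A R`) — defect sub-mean-value in the critical window: the `η`-type
  REGULARITY statement `-Δτ_p ≤ (6A/r²) m`. HARDEST STUB (XL): no gradient/Hessian regularity of `τ_p`
  beyond the `O(1)` Harnack `τ(y) ≥ p τ(x)` is known in `d = 3`.
* `stub_oscillationFloor` (`∀ δ, ∃ β R`) — in the window the three ANTIPODAL differences are not all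
  small: `(β/r)² m² ≤ Σ_i (τ(x+e_i) - τ(x-e_i))²`. UNDIRECTED on purpose (a directed radial decay rate
  `β/r` would iterate to uniform polynomial decay = the summit). The "no plateau" content of the crux
  lives here (XL).
* `stub_massiveDispersion` (`∃ δ B R`) — ring variance floor in the massive regime (OZ neighbour ratios
  `e^{±x_i/(rξ)}`; size L).

Compositions (real proofs): `defect_of_stubs` (case split, `A := max`), `dispersion_of_stubs`
(antipodal differences ≤ 2 × ring variance, `B := min(β²/12, B₂)`), `subharmonicPower_of_pieces`
(convexity amplification), and `SubharmonicPower_of : stub₁ → stub₂ → stub₃ → stub₄ → SubharmonicPower`.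

## Why it dodges the stuck point of the route
The route's only registered content is the one-crux `SubH(s,R)` with `s` unknown ("the power is forced
and free"); refuters bin it RESTATED (it implies uniform polynomial decay of `τ_{p_c}`). Here the power
is OUTPUT, not input: `s = ⌈8A/B⌉₊ + 2` is computed from two exponent-free constants, and the two pieces
separate the world-neutral regularity (`A`) from the conjunct-flavoured non-flatness (`B`), each strictly
weaker than the crux by the cheap probes (strategist bc/Pieces_probe.lean: `Xᵢ → S`, `Xᵢ → X`, `S → Xᵢ`,
`X → Xᵢ` all unsolved) and neither carrying a decay statement.

## Disproof used / Barriers / Dead lines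
No `Disproof.lean` exists for this crux (ledger crux ls: none); negatives index: nothing on
connectivity (sub)harmonicity or oscillation. Barriers as the route header: GaussianDominationRoute is
evaded on the input side (no RP, no `q ≠ 1`; the `s = 1` dead case appears here as `A > 0`);
LaceExpansionHighDimension not triggered (no `η = 0` claim). Dead lines: none registered for this crux.
-/

namespace Summit.CriticalPhenomena.PercolationContinuityZ3.Cruxes.SubharmonicPower.ConvexityAmplification

open Finset
open Literature.Probability.Percolation Literature.Probability.LatticeModels

/-! ## Part A — the glue `PIECE 1 → PIECE 2 → SubharmonicPower` (sorry-free) -/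

/-! ## Elementary convexity inequalities for `t ↦ t^q` -/

/-- Global second-order lower bound at `1`, all `t ≥ 0`:
`t^(n+1) ≥ 1 + (n+1)(t-1) + n (t-1)²` (induction; the defect is `n (t-1)² t ≥ 0`). [folklore] -/
theorem pow_succ_ge_taylor (t : ℝ) (ht : 0 ≤ t) :
    ∀ n : ℕ, 1 + ((n : ℝ) + 1) * (t - 1) + (n : ℝ) * (t - 1) ^ 2 ≤ t ^ (n + 1) := by
  intro n
  induction n with
  | zero => simp
  | succ n ih =>
    have hmul : (1 + ((n : ℝ) + 1) * (t - 1) + (n : ℝ) * (t - 1) ^ 2) * t ≤ t ^ (n + 1) * t :=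
      mul_le_mul_of_nonneg_right ih ht
    have hnn : 0 ≤ (n : ℝ) * (t - 1) ^ 2 * t :=
      mul_nonneg (mul_nonneg n.cast_nonneg (sq_nonneg _)) ht
    have hpow : t ^ (n + 1 + 1) = t ^ (n + 1) * t := pow_succ t (n + 1)
    rw [hpow]
    push_cast
    nlinarith [hmul, hnn]

/-- Local second-order lower bound: for `|u| ≤ δ ≤ 1`,
`(1+u)^n ≥ 1 + n u + (1-δ)^n · (n(n-1)/2) · u²`. [folklore] -/
theorem one_add_pow_ge_taylor_local (u δ : ℝ) (hδ1 : δ ≤ 1) (hu : |u| ≤ δ) :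
    ∀ n : ℕ, 1 + (n : ℝ) * u + (1 - δ) ^ n * ((n : ℝ) * ((n : ℝ) - 1) / 2) * u ^ 2 ≤ (1 + u) ^ n := by
  have hδ0 : 0 ≤ δ := (abs_nonneg u).trans hu
  have hu1 : 1 - δ ≤ 1 + u := by
    have := (abs_le.mp hu).1
    linarith
  have h1δ : 0 ≤ 1 - δ := by linarith
  have h1u : 0 ≤ 1 + u := h1δ.trans hu1
  intro n
  induction n with
  | zero => simp
  | succ n ih =>
    set c : ℝ := (n : ℝ) * ((n : ℝ) - 1) / 2 with hc
    have hc0 : 0 ≤ c := by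
      rcases Nat.eq_zero_or_pos n with h0 | hpos
      · simp [hc, h0]
      · have : (1 : ℝ) ≤ n := by exact_mod_cast hpos
        have : 0 ≤ (n : ℝ) - 1 := by linarith
        positivity
    have hpn : 0 ≤ (1 - δ) ^ n := pow_nonneg h1δ n
    have hpn1 : (1 - δ) ^ (n + 1) ≤ 1 := pow_le_one₀ h1δ (by linarith)
    have hmul : (1 + (n : ℝ) * u + (1 - δ) ^ n * c * u ^ 2) * (1 + u) ≤ (1 + u) ^ n * (1 + u) :=
      mul_le_mul_of_nonneg_right ih h1u
    have hquad : (1 - δ) ^ (n + 1) * c * u ^ 2 ≤ (1 - δ) ^ n * c * u ^ 2 * (1 + u) := by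
      have : (1 - δ) ^ (n + 1) * c * u ^ 2 = (1 - δ) ^ n * c * u ^ 2 * (1 - δ) := by ring
      rw [this]
      exact mul_le_mul_of_nonneg_left hu1 (mul_nonneg (mul_nonneg hpn hc0) (sq_nonneg u))
    have hlin : (1 - δ) ^ (n + 1) * (n : ℝ) * u ^ 2 ≤ (n : ℝ) * u ^ 2 := by
      have h0 : 0 ≤ (n : ℝ) * u ^ 2 := mul_nonneg n.cast_nonneg (sq_nonneg u)
      calc (1 - δ) ^ (n + 1) * (n : ℝ) * u ^ 2 = (1 - δ) ^ (n + 1) * ((n : ℝ) * u ^ 2) := by ring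
        _ ≤ 1 * ((n : ℝ) * u ^ 2) := mul_le_mul_of_nonneg_right hpn1 h0
        _ = (n : ℝ) * u ^ 2 := one_mul _
    have hcoef : ((n + 1 : ℕ) : ℝ) * (((n + 1 : ℕ) : ℝ) - 1) / 2 = c + n := by
      push_cast
      rw [hc]
      ring
    rw [hcoef]
    push_cast
    calc 1 + ((n : ℝ) + 1) * u + (1 - δ) ^ (n + 1) * (c + n) * u ^ 2
        = 1 + ((n : ℝ) + 1) * u + (1 - δ) ^ (n + 1) * c * u ^ 2
            + (1 - δ) ^ (n + 1) * (n : ℝ) * u ^ 2 := by ring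
      _ ≤ 1 + ((n : ℝ) + 1) * u + (1 - δ) ^ n * c * u ^ 2 * (1 + u) + (n : ℝ) * u ^ 2 := by
          linarith [hquad, hlin]
      _ = (1 + (n : ℝ) * u + (1 - δ) ^ n * c * u ^ 2) * (1 + u) := by ring
      _ ≤ (1 + u) ^ n * (1 + u) := hmul
      _ = (1 + u) ^ (n + 1) := (pow_succ (1 + u) n).symm

/-- `(1+a)^n ≤ 1 + 2 n a` for `a ≥ 0` with `2 n a ≤ 1`. [folklore] -/
theorem one_add_pow_le_linear (a : ℝ) (ha : 0 ≤ a) :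
    ∀ n : ℕ, 2 * (n : ℝ) * a ≤ 1 → (1 + a) ^ n ≤ 1 + 2 * (n : ℝ) * a := by
  intro n
  induction n with
  | zero => intro; simp
  | succ n ih =>
    intro h
    push_cast at h ⊢
    have hn : 2 * (n : ℝ) * a ≤ 1 := by nlinarith
    have hmul : (1 + a) ^ n * (1 + a) ≤ (1 + 2 * (n : ℝ) * a) * (1 + a) :=
      mul_le_mul_of_nonneg_right (ih hn) (by linarith)
    rw [pow_succ]
    nlinarith [hmul, mul_le_mul_of_nonneg_left hn ha]

/-- Bernoulli: `(1 - 1/(2q))^q ≥ 1/2` for `q ≥ 1`. [folklore] -/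
theorem half_le_pow (q : ℕ) (hq : 1 ≤ q) : (1 / 2 : ℝ) ≤ (1 - 1 / (2 * (q : ℝ))) ^ q := by
  have h := one_add_mul_le_pow (a := -(1 / (2 * (q : ℝ)))) (by
    have : 1 / (2 * (q : ℝ)) ≤ 1 / 2 :=
      one_div_le_one_div_of_le (by norm_num) (by
        have : (1 : ℝ) ≤ q := by exact_mod_cast hq
        linarith)
    linarith) q
  have hq' : (0 : ℝ) < q := by exact_mod_cast hq
  have : 1 + (q : ℝ) * -(1 / (2 * (q : ℝ))) = 1 / 2 := by
    field_simp
    ring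
  rw [this] at h
  simpa [sub_eq_add_neg] using h

/-! ## The core inequality on a finite family of non-negative numbers with mean one -/

/-- **Convexity amplification (core).** Let `t : ι → ℝ≥0` have mean `1` over a finite index set of
size `N`, squared deviation `S₂ = Σ (t_j - 1)²`, and let `a ≥ 0`, `q ≥ 2` with `2qa ≤ 1`,
`16 N q² a ≤ 1` and `8 a N ≤ (q-1) S₂`.  Then `N (1+a)^q ≤ Σ_j t_j^q`. [folklore] -/
theorem core {ι : Type*} [Fintype ι] (t : ι → ℝ) (ht : ∀ j, 0 ≤ t j)
    {N : ℝ} (hN : (Fintype.card ι : ℝ) = N)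
    (hmean : ∑ j, t j = N) {q : ℕ} (hq : 2 ≤ q) {a : ℝ} (ha : 0 ≤ a)
    (h1 : 2 * (q : ℝ) * a ≤ 1) (h2 : 16 * N * (q : ℝ) ^ 2 * a ≤ 1)
    (h3 : 8 * a * N ≤ ((q : ℝ) - 1) * ∑ j, (t j - 1) ^ 2) :
    (1 + a) ^ q * N ≤ ∑ j, t j ^ q := by
  set S2 := ∑ j, (t j - 1) ^ 2 with hS2
  have hN0 : 0 ≤ N := by rw [← hN]; exact Nat.cast_nonneg _
  have hS20 : 0 ≤ S2 := Finset.sum_nonneg fun j _ => sq_nonneg _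
  obtain ⟨n, rfl⟩ : ∃ n, q = n + 1 := ⟨q - 1, by omega⟩
  have hn1 : 1 ≤ n := by omega
  have hn1' : (1 : ℝ) ≤ n := by exact_mod_cast hn1
  push_cast at h1 h2 h3 ⊢
  have hq0 : (0 : ℝ) < (n : ℝ) + 1 := by positivity
  -- (E3): `(1+a)^q ≤ 1 + 2 q a`
  have hE3 : (1 + a) ^ (n + 1) ≤ 1 + 2 * ((n : ℝ) + 1) * a := by
    have := one_add_pow_le_linear a ha (n + 1) (by push_cast; exact h1)
    push_cast at this
    exact this
  -- the centred first moment vanishes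
  have hsum1 : ∑ j, (t j - 1) = 0 := by
    rw [Finset.sum_sub_distrib, hmean, Finset.sum_const, Finset.card_univ, hN.symm]
    simp
  by_cases hcase : 2 * ((n : ℝ) + 1) * a * N ≤ (n : ℝ) * S2
  · -- Regime A (large dispersion): the global bound summed over the ring
    have hsum : ∑ j, (1 + ((n : ℝ) + 1) * (t j - 1) + (n : ℝ) * (t j - 1) ^ 2)
        ≤ ∑ j, t j ^ (n + 1) :=
      Finset.sum_le_sum fun j _ => pow_succ_ge_taylor (t j) (ht j) n
    have hlhs : ∑ j, (1 + ((n : ℝ) + 1) * (t j - 1) + (n : ℝ) * (t j - 1) ^ 2)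
        = N + (n : ℝ) * S2 := by
      rw [Finset.sum_add_distrib, Finset.sum_add_distrib, Finset.sum_const, Finset.card_univ,
        ← Finset.mul_sum, ← Finset.mul_sum, hsum1, hS2]
      simp [hN.symm]
    rw [hlhs] at hsum
    calc (1 + a) ^ (n + 1) * N ≤ (1 + 2 * ((n : ℝ) + 1) * a) * N :=
          mul_le_mul_of_nonneg_right hE3 hN0
      _ = N + 2 * ((n : ℝ) + 1) * a * N := by ring
      _ ≤ N + (n : ℝ) * S2 := by linarith
      _ ≤ _ := hsum
  · -- Regime B (small dispersion): every deviation is `≤ 1/(2q)`, use the local bound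
    push Not at hcase
    have hS2small : S2 ≤ 4 * a * N := by
      -- `n S2 < 2(n+1) a N ≤ 4 n a N`
      have h4 : 2 * ((n : ℝ) + 1) * a * N ≤ 4 * (n : ℝ) * (a * N) := by
        have haN : 0 ≤ a * N := mul_nonneg ha hN0
        nlinarith
      have hn0 : (0 : ℝ) < n := by linarith
      have : (n : ℝ) * S2 ≤ (n : ℝ) * (4 * a * N) := by nlinarith
      exact le_of_mul_le_mul_left this hn0
    set δ : ℝ := 1 / (2 * ((n : ℝ) + 1)) with hδ
    have hδpos : 0 < δ := by rw [hδ]; positivity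
    have hδ1 : δ ≤ 1 := by
      rw [hδ, div_le_one (by positivity)]
      linarith
    have hdev : ∀ j, |t j - 1| ≤ δ := by
      intro j
      have hj : (t j - 1) ^ 2 ≤ S2 :=
        Finset.single_le_sum (f := fun k => (t k - 1) ^ 2) (fun k _ => sq_nonneg _)
          (Finset.mem_univ j)
      have hsq : (t j - 1) ^ 2 ≤ δ ^ 2 := by
        have : 4 * a * N ≤ δ ^ 2 := by
          rw [hδ, div_pow, one_pow, le_div_iff₀ (by positivity)]
          nlinarith
        linarith
      exact abs_le_of_sq_le_sq hsq hδpos.le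
    -- local bound with `(1-δ)^q ≥ 1/2`
    have hhalf : (1 / 2 : ℝ) ≤ (1 - δ) ^ (n + 1) := by
      have := half_le_pow (n + 1) (by omega)
      push_cast at this
      rw [hδ]
      exact this
    have hE2 : ∀ j, 1 + ((n : ℝ) + 1) * (t j - 1)
        + (1 / 2) * (((n : ℝ) + 1) * (n : ℝ) / 2) * (t j - 1) ^ 2 ≤ t j ^ (n + 1) := by
      intro j
      have h := one_add_pow_ge_taylor_local (t j - 1) δ hδ1 (hdev j) (n + 1)
      push_cast at h
      have hc0 : 0 ≤ (((n : ℝ) + 1) * ((n : ℝ) + 1 - 1) / 2) * (t j - 1) ^ 2 := by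
        have : ((n : ℝ) + 1 - 1) = n := by ring
        rw [this]
        positivity
      have hmono : (1 / 2) * ((((n : ℝ) + 1) * ((n : ℝ) + 1 - 1) / 2) * (t j - 1) ^ 2)
          ≤ (1 - δ) ^ (n + 1) * ((((n : ℝ) + 1) * ((n : ℝ) + 1 - 1) / 2) * (t j - 1) ^ 2) :=
        mul_le_mul_of_nonneg_right hhalf hc0
      have ht1 : 1 + (t j - 1) = t j := by ring
      rw [ht1] at h
      calc 1 + ((n : ℝ) + 1) * (t j - 1) + (1 / 2) * (((n : ℝ) + 1) * (n : ℝ) / 2) * (t j - 1) ^ 2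
          = 1 + ((n : ℝ) + 1) * (t j - 1)
            + (1 / 2) * ((((n : ℝ) + 1) * ((n : ℝ) + 1 - 1) / 2) * (t j - 1) ^ 2) := by ring
        _ ≤ 1 + ((n : ℝ) + 1) * (t j - 1)
            + (1 - δ) ^ (n + 1) * ((((n : ℝ) + 1) * ((n : ℝ) + 1 - 1) / 2) * (t j - 1) ^ 2) := by
            linarith
        _ = 1 + ((n : ℝ) + 1) * (t j - 1)
            + (1 - δ) ^ (n + 1) * (((n : ℝ) + 1) * ((n : ℝ) + 1 - 1) / 2) * (t j - 1) ^ 2 := by ring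
        _ ≤ t j ^ (n + 1) := h
    have hsum : ∑ j, (1 + ((n : ℝ) + 1) * (t j - 1)
        + (1 / 2) * (((n : ℝ) + 1) * (n : ℝ) / 2) * (t j - 1) ^ 2) ≤ ∑ j, t j ^ (n + 1) :=
      Finset.sum_le_sum fun j _ => hE2 j
    have hlhs : ∑ j, (1 + ((n : ℝ) + 1) * (t j - 1)
        + (1 / 2) * (((n : ℝ) + 1) * (n : ℝ) / 2) * (t j - 1) ^ 2)
        = N + (1 / 2) * (((n : ℝ) + 1) * (n : ℝ) / 2) * S2 := by
      rw [Finset.sum_add_distrib, Finset.sum_add_distrib, Finset.sum_const, Finset.card_univ,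
        ← Finset.mul_sum, ← Finset.mul_sum, hsum1, hS2]
      simp [hN.symm]
    rw [hlhs] at hsum
    -- gain `q(q-1) S₂ / 4 ≥ 2 q a N` from `8 a N ≤ (q-1) S₂`
    have hgain : 2 * ((n : ℝ) + 1) * a * N ≤ (1 / 2) * (((n : ℝ) + 1) * (n : ℝ) / 2) * S2 := by
      have h3' : 8 * a * N ≤ (n : ℝ) * S2 := by
        have : ((n : ℝ) + 1 - 1) = n := by ring
        rw [this] at h3
        exact h3
      nlinarith
    calc (1 + a) ^ (n + 1) * N ≤ (1 + 2 * ((n : ℝ) + 1) * a) * N :=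
          mul_le_mul_of_nonneg_right hE3 hN0
      _ = N + 2 * ((n : ℝ) + 1) * a * N := by ring
      _ ≤ N + (1 / 2) * (((n : ℝ) + 1) * (n : ℝ) / 2) * S2 := by linarith
      _ ≤ _ := hsum

/-! ## The split of the crux -/

/-- **`SubharmonicPower` from defect sub-mean-value and ring dispersion** (the glue of the line; same
proof as the strategist's split theorem `Theorems.SubharmonicPowerSplit.subharmonicPower_of_defect_of_dispersion`,
published as `Cruxes/SubharmonicPower/Lines/convexity_amplification_split.lean`; the two hypotheses are
the pieces `DefectSubMeanValue` and `RingDispersion`, written out).  With `A, R₁` from the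
defect bound and `B, R₂` from the dispersion bound, `SubharmonicPower` holds with the natural exponent
`s = q := ⌈8A/B⌉₊ + 2` and `R := max (max R₁ R₂) (max 1 ⌈96 q² A⌉₊)`: normalise the six ring values
by their mean and apply `core` (convexity amplification), then undo the normalisation. [folklore] -/
theorem subharmonicPower_of_pieces
    (hD : ∃ (A : ℝ) (R : ℕ), 0 ≤ A ∧ ∀ p : unitInterval,
      (p : ℝ) < criticalProb (zdGraph 3) (0 : Site 3) → ∀ x : Site 3, (R : ℝ) < ‖x‖ →
        tau 3 p 0 x ≤ (1 + A / ‖x‖ ^ 2) * ((1 / 6 : ℝ) * ∑ i : Fin 3,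
          (tau 3 p 0 (x + Pi.single i 1) + tau 3 p 0 (x - Pi.single i 1))))
    (hV : ∃ (B : ℝ) (R : ℕ), 0 < B ∧ ∀ p : unitInterval,
      (p : ℝ) < criticalProb (zdGraph 3) (0 : Site 3) → ∀ x : Site 3, (R : ℝ) < ‖x‖ →
        (1 + B / ‖x‖ ^ 2) * ((1 / 6 : ℝ) * ∑ i : Fin 3,
          (tau 3 p 0 (x + Pi.single i 1) + tau 3 p 0 (x - Pi.single i 1))) ^ 2 ≤
        (1 / 6 : ℝ) * ∑ i : Fin 3,
          (tau 3 p 0 (x + Pi.single i 1) ^ 2 + tau 3 p 0 (x - Pi.single i 1) ^ 2)) :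
    -- the crux `PercSubharmonicSquare.SubharmonicPower`, written out (only `SubharmonicPower_of`
    -- below concludes the crux BY NAME, so that the skeleton check reads the four stubs)
    ∃ (s : ℝ) (R : ℕ), 0 < s ∧ ∀ p : unitInterval,
      (p : ℝ) < criticalProb (zdGraph 3) (0 : Site 3) → ∀ x : Site 3, (R : ℝ) < ‖x‖ →
        tau 3 p 0 x ^ s ≤ (1 / 6 : ℝ) * ∑ i : Fin 3,
          (tau 3 p 0 (x + Pi.single i 1) ^ s + tau 3 p 0 (x - Pi.single i 1) ^ s) := by
  obtain ⟨A, R₁, hA, hdef⟩ := hD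
  obtain ⟨B, R₂, hB, hdisp⟩ := hV
  -- the exponent `q = ⌈8A/B⌉₊ + 2` and the box `R`
  set q : ℕ := ⌈8 * A / B⌉₊ + 2 with hq
  have hq2 : 2 ≤ q := by rw [hq]; omega
  have hq1 : 8 * A / B ≤ (q : ℝ) - 1 := by
    have h := Nat.le_ceil (8 * A / B)
    rw [hq]
    push_cast
    linarith
  have hqpos : (0 : ℝ) < q := by exact_mod_cast (show 0 < q by omega)
  set R : ℕ := max (max R₁ R₂) (max 1 ⌈96 * (q : ℝ) ^ 2 * A⌉₊) with hR
  refine ⟨(q : ℝ), R, hqpos, ?_⟩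
  intro p hp x hx
  -- unpack `R < ‖x‖`
  rw [hR] at hx
  push_cast at hx
  simp only [max_lt_iff] at hx
  obtain ⟨⟨hx1, hx2⟩, hx3, hx4⟩ := hx
  set r : ℝ := ‖x‖ with hr
  have hr0 : 0 < r := by linarith
  have hr96 : 96 * (q : ℝ) ^ 2 * A ≤ r ^ 2 := by
    have h := Nat.le_ceil (96 * (q : ℝ) ^ 2 * A)
    nlinarith
  -- real powers with a natural exponent are monoid powers
  simp only [Real.rpow_natCast]
  -- the six ring values and their mean
  set F : Fin 3 → ℝ := fun i => tau 3 p 0 (x + Pi.single i 1) with hF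
  set G : Fin 3 → ℝ := fun i => tau 3 p 0 (x - Pi.single i 1) with hG
  have hF0 : ∀ i, 0 ≤ F i := fun i => tau_nonneg p 0 _
  have hG0 : ∀ i, 0 ≤ G i := fun i => tau_nonneg p 0 _
  set m : ℝ := (1 / 6 : ℝ) * ∑ i : Fin 3, (F i + G i) with hm
  have hm0 : 0 ≤ m := by
    rw [hm]
    exact mul_nonneg (by norm_num) (Finset.sum_nonneg fun i _ => add_nonneg (hF0 i) (hG0 i))
  have hdef' : tau 3 p 0 x ≤ (1 + A / r ^ 2) * m := hdef p hp x hx1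
  have hdisp' : (1 + B / r ^ 2) * m ^ 2 ≤ (1 / 6 : ℝ) * ∑ i : Fin 3, (F i ^ 2 + G i ^ 2) :=
    hdisp p hp x hx2
  have hτ0 : 0 ≤ tau 3 p 0 x := tau_nonneg p 0 x
  have ha : 0 ≤ A / r ^ 2 := by positivity
  show tau 3 p 0 x ^ q ≤ (1 / 6 : ℝ) * ∑ i : Fin 3, (F i ^ q + G i ^ q)
  have hrhs0 : 0 ≤ (1 / 6 : ℝ) * ∑ i : Fin 3, (F i ^ q + G i ^ q) :=
    mul_nonneg (by norm_num)
      (Finset.sum_nonneg fun i _ => add_nonneg (pow_nonneg (hF0 i) q) (pow_nonneg (hG0 i) q))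
  rcases hm0.eq_or_lt with hmz | hmpos
  · -- degenerate ring (`m = 0`, e.g. `p = 0`): then `τ(x) = 0`
    have hτz : tau 3 p 0 x = 0 := le_antisymm (by rw [← hmz, mul_zero] at hdef'; exact hdef') hτ0
    rw [hτz, zero_pow (by omega)]
    exact hrhs0
  -- normalised ring values `t = τ/m` on `Fin 3 ⊕ Fin 3`
  set t : Fin 3 ⊕ Fin 3 → ℝ := Sum.elim (fun i => F i / m) (fun i => G i / m) with ht
  have ht0 : ∀ j, 0 ≤ t j := by
    rintro (i | i)
    · exact div_nonneg (hF0 i) hmpos.le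
    · exact div_nonneg (hG0 i) hmpos.le
  have hN : (Fintype.card (Fin 3 ⊕ Fin 3) : ℝ) = 6 := by
    norm_num [Fintype.card_sum]
  have hsumFG : ∑ i : Fin 3, (F i + G i) = 6 * m := by
    rw [hm]
    ring
  have hmean : ∑ j, t j = 6 := by
    rw [Fintype.sum_sum_type]
    simp only [ht, Sum.elim_inl, Sum.elim_inr]
    rw [← Finset.sum_div, ← Finset.sum_div, ← add_div, ← Finset.sum_add_distrib, hsumFG]
    field_simp
  have hsumsq : ∑ j, t j ^ 2 = (∑ i : Fin 3, (F i ^ 2 + G i ^ 2)) / m ^ 2 := by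
    rw [Fintype.sum_sum_type]
    simp only [ht, Sum.elim_inl, Sum.elim_inr, div_pow]
    rw [← Finset.sum_div, ← Finset.sum_div, ← add_div, ← Finset.sum_add_distrib]
  have hsumq : ∑ j, t j ^ q = (∑ i : Fin 3, (F i ^ q + G i ^ q)) / m ^ q := by
    rw [Fintype.sum_sum_type]
    simp only [ht, Sum.elim_inl, Sum.elim_inr, div_pow]
    rw [← Finset.sum_div, ← Finset.sum_div, ← add_div, ← Finset.sum_add_distrib]
  -- the dispersion hypothesis as a lower bound on the squared deviation
  have hS2 : 6 * (B / r ^ 2) ≤ ∑ j, (t j - 1) ^ 2 := by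
    have hexp : ∑ j, (t j - 1) ^ 2 = ∑ j, t j ^ 2 - 2 * ∑ j, t j + 6 := by
      rw [Finset.mul_sum, ← Finset.sum_sub_distrib]
      have : ∑ j, (t j - 1) ^ 2 = ∑ j, ((t j ^ 2 - 2 * t j) + 1) :=
        Finset.sum_congr rfl fun j _ => by ring
      rw [this, Finset.sum_add_distrib, Finset.sum_const, Finset.card_univ]
      norm_num [Fintype.card_sum]
    have hsq6 : 6 * (1 + B / r ^ 2) ≤ ∑ j, t j ^ 2 := by
      rw [hsumsq, le_div_iff₀ (by positivity)]
      nlinarith [hdisp']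
    rw [hexp, hmean]
    linarith
  -- hypotheses of `core` with `a = A/r²`, `N = 6`
  have h1 : 2 * (q : ℝ) * (A / r ^ 2) ≤ 1 := by
    rw [show 2 * (q : ℝ) * (A / r ^ 2) = (2 * (q : ℝ) * A) / r ^ 2 by ring,
      div_le_one (by positivity)]
    have hq2' : (2 : ℝ) ≤ q := by exact_mod_cast hq2
    have : (2 : ℝ) * q ≤ 96 * (q : ℝ) ^ 2 := by nlinarith
    nlinarith
  have h2 : 16 * 6 * (q : ℝ) ^ 2 * (A / r ^ 2) ≤ 1 := by
    rw [show 16 * 6 * (q : ℝ) ^ 2 * (A / r ^ 2) = (96 * (q : ℝ) ^ 2 * A) / r ^ 2 by ring,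
      div_le_one (by positivity)]
    exact hr96
  have h3 : 8 * (A / r ^ 2) * 6 ≤ ((q : ℝ) - 1) * ∑ j, (t j - 1) ^ 2 := by
    have hq1' : 8 * A ≤ ((q : ℝ) - 1) * B := by
      have := (div_le_iff₀ hB).mp hq1
      linarith
    have hqm : 0 ≤ (q : ℝ) - 1 := by
      have : (2 : ℝ) ≤ q := by exact_mod_cast hq2
      linarith
    calc 8 * (A / r ^ 2) * 6 = (8 * A) * (6 / r ^ 2) := by ring
      _ ≤ (((q : ℝ) - 1) * B) * (6 / r ^ 2) :=
          mul_le_mul_of_nonneg_right hq1' (by positivity)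
      _ = ((q : ℝ) - 1) * (6 * (B / r ^ 2)) := by ring
      _ ≤ ((q : ℝ) - 1) * ∑ j, (t j - 1) ^ 2 := mul_le_mul_of_nonneg_left hS2 hqm
  have hcore := core t ht0 hN hmean hq2 ha h1 h2 h3
  -- undo the normalisation
  rw [hsumq, le_div_iff₀ (pow_pos hmpos q)] at hcore
  have hmq : 0 ≤ m ^ q := pow_nonneg hmpos.le q
  calc tau 3 p 0 x ^ q ≤ ((1 + A / r ^ 2) * m) ^ q := pow_le_pow_left₀ hτ0 hdef' q
    _ = (1 + A / r ^ 2) ^ q * m ^ q := mul_pow _ _ _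
    _ = ((1 + A / r ^ 2) ^ q * 6 * m ^ q) * (1 / 6) := by ring
    _ ≤ (∑ i : Fin 3, (F i ^ q + G i ^ q)) * (1 / 6) :=
        mul_le_mul_of_nonneg_right hcore (by norm_num)
    _ = (1 / 6 : ℝ) * ∑ i : Fin 3, (F i ^ q + G i ^ q) := by ring

/-! ## Part B — the four registered stubs: precise `Prop`s `Stubs.stub_*` + sorried theorems `stub_*`

D-0027 §3.3 shape: `SubharmonicPower_of : Stubs.stub_massiveDefect → Stubs.stub_windowDefect →
Stubs.stub_oscillationFloor → Stubs.stub_massiveDispersion → SubharmonicPower` (hypotheses = the declared stub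
`Prop`s BY NAME), `stub_* : <Stubs.stub_* spelled out> := by sorry`, and
`SubharmonicPower_proof : SubharmonicPower := SubharmonicPower_of stub_massiveDefect …` (the skeleton IS the
crux proof once the four sorries are discharged; the application type-checks by unfolding). -/

namespace Stubs

/-- **Stub `Prop`** — defect sub-mean-value in the massive regime (piece `DefectSubMeanValue`). Spelled out and sorried as `stub_massiveDefect` below. -/
def stub_massiveDefect : Prop :=
    ∃ (δ : ℝ) (A : ℝ) (R : ℕ), 0 < δ ∧ 0 ≤ A ∧ ∀ p : unitInterval,
      (p : ℝ) < criticalProb (zdGraph 3) (0 : Site 3) → ∀ x : Site 3, (R : ℝ) < ‖x‖ →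
        tau 3 p 0 x * ‖x‖ ≤ δ →
        tau 3 p 0 x ≤ (1 + A / ‖x‖ ^ 2) * ((1 / 6 : ℝ) * ∑ i : Fin 3,
          (tau 3 p 0 (x + Pi.single i 1) + tau 3 p 0 (x - Pi.single i 1)))

/-- **Stub `Prop`** — defect sub-mean-value in the critical window (piece `DefectSubMeanValue`; hardest). Spelled out and sorried as `stub_windowDefect` below. -/
def stub_windowDefect : Prop :=
    ∀ δ : ℝ, 0 < δ → ∃ (A : ℝ) (R : ℕ), 0 ≤ A ∧ ∀ p : unitInterval,
      (p : ℝ) < criticalProb (zdGraph 3) (0 : Site 3) → ∀ x : Site 3, (R : ℝ) < ‖x‖ →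
        δ < tau 3 p 0 x * ‖x‖ →
        tau 3 p 0 x ≤ (1 + A / ‖x‖ ^ 2) * ((1 / 6 : ℝ) * ∑ i : Fin 3,
          (tau 3 p 0 (x + Pi.single i 1) + tau 3 p 0 (x - Pi.single i 1)))

/-- **Stub `Prop`** — antipodal oscillation floor in the critical window (piece `RingDispersion`). Spelled out and sorried as `stub_oscillationFloor` below. -/
def stub_oscillationFloor : Prop :=
    ∀ δ : ℝ, 0 < δ → ∃ (β : ℝ) (R : ℕ), 0 < β ∧ ∀ p : unitInterval,
      (p : ℝ) < criticalProb (zdGraph 3) (0 : Site 3) → ∀ x : Site 3, (R : ℝ) < ‖x‖ →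
        δ < tau 3 p 0 x * ‖x‖ →
        (β / ‖x‖) ^ 2 * ((1 / 6 : ℝ) * ∑ i : Fin 3,
          (tau 3 p 0 (x + Pi.single i 1) + tau 3 p 0 (x - Pi.single i 1))) ^ 2 ≤
        ∑ i : Fin 3, (tau 3 p 0 (x + Pi.single i 1) - tau 3 p 0 (x - Pi.single i 1)) ^ 2

/-- **Stub `Prop`** — ring dispersion in the massive regime (piece `RingDispersion`). Spelled out and sorried as `stub_massiveDispersion` below. -/
def stub_massiveDispersion : Prop :=
    ∃ (δ : ℝ) (B : ℝ) (R : ℕ), 0 < δ ∧ 0 < B ∧ ∀ p : unitInterval,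
      (p : ℝ) < criticalProb (zdGraph 3) (0 : Site 3) → ∀ x : Site 3, (R : ℝ) < ‖x‖ →
        tau 3 p 0 x * ‖x‖ ≤ δ →
        (1 + B / ‖x‖ ^ 2) * ((1 / 6 : ℝ) * ∑ i : Fin 3,
          (tau 3 p 0 (x + Pi.single i 1) + tau 3 p 0 (x - Pi.single i 1))) ^ 2 ≤
        (1 / 6 : ℝ) * ∑ i : Fin 3,
          (tau 3 p 0 (x + Pi.single i 1) ^ 2 + tau 3 p 0 (x - Pi.single i 1) ^ 2)

end Stubs

/-- **Stub 1 of 4 (massive / Ornstein–Zernike regime; piece `DefectSubMeanValue`).** There are `δ > 0`, `A ≥ 0`, `R` such that for every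
`p < p_c(ℤ³)` and every `‖x‖ > R` with `τ_p(0,x)·‖x‖ ≤ δ` (i.e. `‖x‖ ≳ ξ(p) log(1/δ)`),
`τ_p(0,x) ≤ (1 + A/‖x‖²) m_p(x)`. Why plausibly true: the OZ profile `e^{-r/ξ}/r` is strictly
subharmonic (`Δu = u/ξ²`), uniformly in the direction-dependence of `ξ`; `p ≤ 1/6` is the proved
`SmallDensitySubharmonic` (`A = 0`). Size: L (uniform OZ up to second differences). -/
theorem stub_massiveDefect :
    ∃ (δ : ℝ) (A : ℝ) (R : ℕ), 0 < δ ∧ 0 ≤ A ∧ ∀ p : unitInterval,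
      (p : ℝ) < criticalProb (zdGraph 3) (0 : Site 3) → ∀ x : Site 3, (R : ℝ) < ‖x‖ →
        tau 3 p 0 x * ‖x‖ ≤ δ →
        tau 3 p 0 x ≤ (1 + A / ‖x‖ ^ 2) * ((1 / 6 : ℝ) * ∑ i : Fin 3,
          (tau 3 p 0 (x + Pi.single i 1) + tau 3 p 0 (x - Pi.single i 1))) := by
  sorry

/-- **Stub 2 of 4 (critical window; piece `DefectSubMeanValue`; the HARDEST stub).** For every `δ > 0` there are `A ≥ 0`, `R` such that for every
`p < p_c(ℤ³)` and every `‖x‖ > R` with `τ_p(0,x)·‖x‖ > δ` (i.e. `‖x‖ ≲ ξ(p)·polylog`; at `p_c` every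
far site), `τ_p(0,x) ≤ (1 + A/‖x‖²) m_p(x)`. Why plausibly true: for the critical law `r^{-(1+η)}`,
`η < 0`, the defect is `a(1-a)/(6r²)`; world-neutral (plateau approaches have defect `≤ 1/(6r²)`).
The hardest stub: an `r⁻²` one-sided second-difference bound with no known gradient regularity of
`τ_p` in `d = 3`. Size: XL. -/
theorem stub_windowDefect :
    ∀ δ : ℝ, 0 < δ → ∃ (A : ℝ) (R : ℕ), 0 ≤ A ∧ ∀ p : unitInterval,
      (p : ℝ) < criticalProb (zdGraph 3) (0 : Site 3) → ∀ x : Site 3, (R : ℝ) < ‖x‖ →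
        δ < tau 3 p 0 x * ‖x‖ →
        tau 3 p 0 x ≤ (1 + A / ‖x‖ ^ 2) * ((1 / 6 : ℝ) * ∑ i : Fin 3,
          (tau 3 p 0 (x + Pi.single i 1) + tau 3 p 0 (x - Pi.single i 1))) := by
  sorry

/-- **Stub 3 of 4 (antipodal oscillation floor in the critical window; piece `RingDispersion`).** For every `δ > 0`
there are `β > 0` and `R` such that for `p < p_c(ℤ³)`, `‖x‖ > R` and `τ_p(0,x)·‖x‖ > δ`, the three
antipodal differences are not all small: `(β/‖x‖)² m_p(x)² ≤ Σ_i (τ_p(0,x+e_i) - τ_p(0,x-e_i))²`.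
Why plausibly true: along the major axis `|x_i| = ‖x‖∞` a profile `r^{-a} g(r/ξ)` with `g` decreasing
has antipodal difference `≥ (2a/√3) τ/r`, `a = 1+η ≈ 0.95 > 0`. Why it might fail: it is the
"no plateau" content (false at `r ≪ ξ'` in a jump world); even under continuity, lattice saddles of
`τ_p` are not excluded by any known inequality. Size: XL. -/
theorem stub_oscillationFloor :
    ∀ δ : ℝ, 0 < δ → ∃ (β : ℝ) (R : ℕ), 0 < β ∧ ∀ p : unitInterval,
      (p : ℝ) < criticalProb (zdGraph 3) (0 : Site 3) → ∀ x : Site 3, (R : ℝ) < ‖x‖ →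
        δ < tau 3 p 0 x * ‖x‖ →
        (β / ‖x‖) ^ 2 * ((1 / 6 : ℝ) * ∑ i : Fin 3,
          (tau 3 p 0 (x + Pi.single i 1) + tau 3 p 0 (x - Pi.single i 1))) ^ 2 ≤
        ∑ i : Fin 3, (tau 3 p 0 (x + Pi.single i 1) - tau 3 p 0 (x - Pi.single i 1)) ^ 2 := by
  sorry

/-- **Stub 4 of 4 (ring dispersion in the massive regime; piece `RingDispersion`).** There are `δ > 0`, `B > 0`, `R` such that for
`p < p_c(ℤ³)`, `‖x‖ > R` and `τ_p(0,x)·‖x‖ ≤ δ`, the ring variance floor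
`(1 + B/‖x‖²) m_p(x)² ≤ (1/6) Σ_{y ∼ x} τ_p(0,y)²` holds. Why plausibly true: Ornstein–Zernike ratios
`τ(x ∓ e_i)/τ(x) ≈ e^{±x_i/(rξ)}` give relative variance `≈ 1/(3ξ(p)²) ≫ 1/r²` for `r ≳ ξ log(1/δ)`;
`p = 0` is `0 ≤ 0`. Needs uniform-in-`p` OZ lower AND upper bounds on neighbour ratios. Size: L. -/
theorem stub_massiveDispersion :
    ∃ (δ : ℝ) (B : ℝ) (R : ℕ), 0 < δ ∧ 0 < B ∧ ∀ p : unitInterval,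
      (p : ℝ) < criticalProb (zdGraph 3) (0 : Site 3) → ∀ x : Site 3, (R : ℝ) < ‖x‖ →
        tau 3 p 0 x * ‖x‖ ≤ δ →
        (1 + B / ‖x‖ ^ 2) * ((1 / 6 : ℝ) * ∑ i : Fin 3,
          (tau 3 p 0 (x + Pi.single i 1) + tau 3 p 0 (x - Pi.single i 1))) ^ 2 ≤
        (1 / 6 : ℝ) * ∑ i : Fin 3,
          (tau 3 p 0 (x + Pi.single i 1) ^ 2 + tau 3 p 0 (x - Pi.single i 1) ^ 2) := by
  sorry

/-! ## Part C — compositions (real proofs) -/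

/-- **Composition (real proof).** The two regimes exhaust the far sites; the bound is monotone in `A`
because the ring mean is non-negative. [folklore] -/
theorem defect_of_stubs
    (h1 : ∃ (δ : ℝ) (A : ℝ) (R : ℕ), 0 < δ ∧ 0 ≤ A ∧ ∀ p : unitInterval,
      (p : ℝ) < criticalProb (zdGraph 3) (0 : Site 3) → ∀ x : Site 3, (R : ℝ) < ‖x‖ →
        tau 3 p 0 x * ‖x‖ ≤ δ →
        tau 3 p 0 x ≤ (1 + A / ‖x‖ ^ 2) * ((1 / 6 : ℝ) * ∑ i : Fin 3,
          (tau 3 p 0 (x + Pi.single i 1) + tau 3 p 0 (x - Pi.single i 1))))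
    (h2 : ∀ δ : ℝ, 0 < δ → ∃ (A : ℝ) (R : ℕ), 0 ≤ A ∧ ∀ p : unitInterval,
      (p : ℝ) < criticalProb (zdGraph 3) (0 : Site 3) → ∀ x : Site 3, (R : ℝ) < ‖x‖ →
        δ < tau 3 p 0 x * ‖x‖ →
        tau 3 p 0 x ≤ (1 + A / ‖x‖ ^ 2) * ((1 / 6 : ℝ) * ∑ i : Fin 3,
          (tau 3 p 0 (x + Pi.single i 1) + tau 3 p 0 (x - Pi.single i 1)))) :
    ∃ (A : ℝ) (R : ℕ), 0 ≤ A ∧ ∀ p : unitInterval,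
      (p : ℝ) < criticalProb (zdGraph 3) (0 : Site 3) → ∀ x : Site 3, (R : ℝ) < ‖x‖ →
        tau 3 p 0 x ≤ (1 + A / ‖x‖ ^ 2) * ((1 / 6 : ℝ) * ∑ i : Fin 3,
          (tau 3 p 0 (x + Pi.single i 1) + tau 3 p 0 (x - Pi.single i 1))) := by
  obtain ⟨δ, A₁, R₁, hδ, hA₁, H1⟩ := h1
  obtain ⟨A₂, R₂, hA₂, H2⟩ := h2 δ hδ
  refine ⟨max A₁ A₂, max R₁ R₂, le_max_of_le_left hA₁, ?_⟩
  intro p hp x hx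
  push_cast at hx
  obtain ⟨hx1, hx2⟩ := max_lt_iff.mp hx
  -- the ring mean is non-negative, so the bound is monotone in `A`
  have hm : 0 ≤ (1 / 6 : ℝ) * ∑ i : Fin 3,
      (tau 3 p 0 (x + Pi.single i 1) + tau 3 p 0 (x - Pi.single i 1)) :=
    mul_nonneg (by norm_num)
      (Finset.sum_nonneg fun i _ => add_nonneg (tau_nonneg p 0 _) (tau_nonneg p 0 _))
  have hmono : ∀ A : ℝ, A ≤ max A₁ A₂ →
      (1 + A / ‖x‖ ^ 2) * ((1 / 6 : ℝ) * ∑ i : Fin 3,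
        (tau 3 p 0 (x + Pi.single i 1) + tau 3 p 0 (x - Pi.single i 1))) ≤
      (1 + max A₁ A₂ / ‖x‖ ^ 2) * ((1 / 6 : ℝ) * ∑ i : Fin 3,
        (tau 3 p 0 (x + Pi.single i 1) + tau 3 p 0 (x - Pi.single i 1))) := by
    intro A hA
    apply mul_le_mul_of_nonneg_right _ hm
    have : A / ‖x‖ ^ 2 ≤ max A₁ A₂ / ‖x‖ ^ 2 :=
      div_le_div_of_nonneg_right hA (sq_nonneg _)
    linarith
  rcases le_or_gt (tau 3 p 0 x * ‖x‖) δ with hle | hlt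
  · exact (H1 p hp x hx1 hle).trans (hmono A₁ (le_max_left _ _))
  · exact (H2 p hp x hx2 hlt).trans (hmono A₂ (le_max_right _ _))

/-- Antipodal squared differences are dominated by twice the squared deviations from any centre `m`:
`Σ_i (u_i - v_i)² ≤ 2 Σ_i ((u_i - m)² + (v_i - m)²)`. [folklore] -/
theorem sum_sq_sub_le (u v : Fin 3 → ℝ) (m : ℝ) :
    ∑ i, (u i - v i) ^ 2 ≤ 2 * ∑ i, ((u i - m) ^ 2 + (v i - m) ^ 2) := by
  rw [Finset.mul_sum]
  refine Finset.sum_le_sum fun i _ => ?_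
  nlinarith [sq_nonneg (u i + v i - 2 * m)]

/-- The variance identity on the ring: `Σ_i ((u_i - m)² + (v_i - m)²) = Σ_i (u_i² + v_i²) - 6 m²`
when `m` is the mean `(1/6) Σ_i (u_i + v_i)`. [folklore] -/
theorem sum_sq_dev_eq (u v : Fin 3 → ℝ) (m : ℝ) (hm : m = (1 / 6 : ℝ) * ∑ i, (u i + v i)) :
    ∑ i, ((u i - m) ^ 2 + (v i - m) ^ 2) = ∑ i, (u i ^ 2 + v i ^ 2) - 6 * m ^ 2 := by
  have hsum : ∑ i, (u i + v i) = 6 * m := by rw [hm]; ring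
  have : ∑ i, ((u i - m) ^ 2 + (v i - m) ^ 2)
      = ∑ i, (u i ^ 2 + v i ^ 2) - 2 * m * ∑ i, (u i + v i) + ∑ _i : Fin 3, 2 * m ^ 2 := by
    rw [Finset.mul_sum, ← Finset.sum_sub_distrib, ← Finset.sum_add_distrib]
    exact Finset.sum_congr rfl fun i _ => by ring
  rw [this, hsum, Finset.sum_const, Finset.card_univ, Fintype.card_fin]
  simp only [nsmul_eq_mul, Nat.cast_ofNat]
  ring

/-- **Composition (real proof).** In the window, stub 1 and the two identities above give the
variance floor with `B = β²/12`; in the massive regime stub 2 gives it with `B₂`; take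
`B := min (β²/12) B₂`, `R := max R₁ R₂`. [folklore] -/
theorem dispersion_of_stubs
    (h1 : ∀ δ : ℝ, 0 < δ → ∃ (β : ℝ) (R : ℕ), 0 < β ∧ ∀ p : unitInterval,
      (p : ℝ) < criticalProb (zdGraph 3) (0 : Site 3) → ∀ x : Site 3, (R : ℝ) < ‖x‖ →
        δ < tau 3 p 0 x * ‖x‖ →
        (β / ‖x‖) ^ 2 * ((1 / 6 : ℝ) * ∑ i : Fin 3,
          (tau 3 p 0 (x + Pi.single i 1) + tau 3 p 0 (x - Pi.single i 1))) ^ 2 ≤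
        ∑ i : Fin 3, (tau 3 p 0 (x + Pi.single i 1) - tau 3 p 0 (x - Pi.single i 1)) ^ 2)
    (h2 : ∃ (δ : ℝ) (B : ℝ) (R : ℕ), 0 < δ ∧ 0 < B ∧ ∀ p : unitInterval,
      (p : ℝ) < criticalProb (zdGraph 3) (0 : Site 3) → ∀ x : Site 3, (R : ℝ) < ‖x‖ →
        tau 3 p 0 x * ‖x‖ ≤ δ →
        (1 + B / ‖x‖ ^ 2) * ((1 / 6 : ℝ) * ∑ i : Fin 3,
          (tau 3 p 0 (x + Pi.single i 1) + tau 3 p 0 (x - Pi.single i 1))) ^ 2 ≤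
        (1 / 6 : ℝ) * ∑ i : Fin 3,
          (tau 3 p 0 (x + Pi.single i 1) ^ 2 + tau 3 p 0 (x - Pi.single i 1) ^ 2)) :
    ∃ (B : ℝ) (R : ℕ), 0 < B ∧ ∀ p : unitInterval,
      (p : ℝ) < criticalProb (zdGraph 3) (0 : Site 3) → ∀ x : Site 3, (R : ℝ) < ‖x‖ →
        (1 + B / ‖x‖ ^ 2) * ((1 / 6 : ℝ) * ∑ i : Fin 3,
          (tau 3 p 0 (x + Pi.single i 1) + tau 3 p 0 (x - Pi.single i 1))) ^ 2 ≤
        (1 / 6 : ℝ) * ∑ i : Fin 3,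
          (tau 3 p 0 (x + Pi.single i 1) ^ 2 + tau 3 p 0 (x - Pi.single i 1) ^ 2) := by
  obtain ⟨δ, B₂, R₂, hδ, hB₂, H2⟩ := h2
  obtain ⟨β, R₁, hβ, H1⟩ := h1 δ hδ
  refine ⟨min (β ^ 2 / 12) B₂, max R₁ R₂, lt_min (by positivity) hB₂, ?_⟩
  intro p hp x hx
  push_cast at hx
  obtain ⟨hx1, hx2⟩ := max_lt_iff.mp hx
  set u : Fin 3 → ℝ := fun i => tau 3 p 0 (x + Pi.single i 1) with hu
  set v : Fin 3 → ℝ := fun i => tau 3 p 0 (x - Pi.single i 1) with hv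
  set m : ℝ := (1 / 6 : ℝ) * ∑ i, (u i + v i) with hm
  have hm2 : 0 ≤ m ^ 2 := sq_nonneg m
  show (1 + min (β ^ 2 / 12) B₂ / ‖x‖ ^ 2) * m ^ 2 ≤ (1 / 6 : ℝ) * ∑ i, (u i ^ 2 + v i ^ 2)
  rcases le_or_gt (tau 3 p 0 x * ‖x‖) δ with hle | hlt
  · -- massive regime: stub 2, and monotonicity of the left side in `B`
    have h := H2 p hp x hx2 hle
    have hmono : (1 + min (β ^ 2 / 12) B₂ / ‖x‖ ^ 2) * m ^ 2 ≤ (1 + B₂ / ‖x‖ ^ 2) * m ^ 2 := by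
      apply mul_le_mul_of_nonneg_right _ hm2
      have : min (β ^ 2 / 12) B₂ / ‖x‖ ^ 2 ≤ B₂ / ‖x‖ ^ 2 :=
        div_le_div_of_nonneg_right (min_le_right _ _) (sq_nonneg _)
      linarith
    exact hmono.trans h
  · -- critical window: stub 1 + the two ring identities
    have h := H1 p hp x hx1 hlt
    change (β / ‖x‖) ^ 2 * m ^ 2 ≤ ∑ i, (u i - v i) ^ 2 at h
    have hdom := sum_sq_sub_le u v m
    have hid := sum_sq_dev_eq u v m hm
    have hmono : (1 + min (β ^ 2 / 12) B₂ / ‖x‖ ^ 2) * m ^ 2 ≤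
        (1 + (β ^ 2 / 12) / ‖x‖ ^ 2) * m ^ 2 := by
      apply mul_le_mul_of_nonneg_right _ hm2
      have : min (β ^ 2 / 12) B₂ / ‖x‖ ^ 2 ≤ (β ^ 2 / 12) / ‖x‖ ^ 2 :=
        div_le_div_of_nonneg_right (min_le_left _ _) (sq_nonneg _)
      linarith
    refine hmono.trans ?_
    have hβx : (β / ‖x‖) ^ 2 = β ^ 2 / ‖x‖ ^ 2 := by rw [div_pow]
    rw [hβx] at h
    -- `(β²/r²) m² ≤ Σ (u-v)² ≤ 2 (Σ (u²+v²) - 6 m²)`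
    have key : β ^ 2 / ‖x‖ ^ 2 * m ^ 2 ≤ 2 * (∑ i, (u i ^ 2 + v i ^ 2) - 6 * m ^ 2) := by
      rw [← hid]; exact h.trans hdom
    have : (1 + (β ^ 2 / 12) / ‖x‖ ^ 2) * m ^ 2 = m ^ 2 + (1 / 12) * (β ^ 2 / ‖x‖ ^ 2 * m ^ 2) := by
      ring
    rw [this]
    linarith

/-- **The skeleton theorem: the four stub `Prop`s (BY NAME) conclude the crux BY NAME** (kernel-checked,
no `sorry`): unfold the stubs, build the two pieces, apply the convexity-amplification glue. [folklore] -/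
theorem SubharmonicPower_of (h1 : Stubs.stub_massiveDefect) (h2 : Stubs.stub_windowDefect)
    (h3 : Stubs.stub_oscillationFloor) (h4 : Stubs.stub_massiveDispersion) :
    Summit.CriticalPhenomena.PercolationContinuityZ3.Theses.PercSubharmonicSquare.SubharmonicPower := by
  unfold Stubs.stub_massiveDefect at h1
  unfold Stubs.stub_windowDefect at h2
  unfold Stubs.stub_oscillationFloor at h3
  unfold Stubs.stub_massiveDispersion at h4
  exact subharmonicPower_of_pieces (defect_of_stubs h1 h2) (dispersion_of_stubs h3 h4)

/-- **The skeleton IS the crux proof** (D-0027 §3.3): `SubharmonicPower` from the four registered stubs;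
sorry-free as soon as the four `stub_*` are discharged. -/
theorem SubharmonicPower_proof :
    Summit.CriticalPhenomena.PercolationContinuityZ3.Theses.PercSubharmonicSquare.SubharmonicPower :=
  SubharmonicPower_of stub_massiveDefect stub_windowDefect stub_oscillationFloor stub_massiveDispersion

end Summit.CriticalPhenomena.PercolationContinuityZ3.Cruxes.SubharmonicPower.ConvexityAmplification
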